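import Mathlib
import Literature.NumberTheory.Irrationality.RhinViola2001.GroupStructure
import HarnessLib

/-!
# Rhin–Viola 2001, §3 — I: the triple contour integral `Ĩ` as an iterated residue (a closed form)

Topic `Literature/NumberTheory/Irrationality/RhinViola2001`. First of two files (cell `zeta5-irr`, seat zi-lit g16)
DISCHARGING the named fact `theorem31` of `GroupStructure.lean`: G. Rhin, C. Viola, *The group structure for ζ(3)*,
Acta Arith. **97** (2001) 269–293 [RhinViola2001], §3, **Lemma 3.1** and **Theorem 3.1** (pp. 276–279, read on the
page, held text `paper:doi-10-4064-aa97-3-6`): for non-negative `h, …, s` with (2.2)–(2.3) and any radii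
`ρ₁, ρ₂, ρ₃ > 0`, "the integer `b` in (2.9) [`I = a + 2bζ(3)`] is given by
`b = (2πi)^{−3} ∫_C ∫_{C_x} ∫_{C_{x,y}} x^h(1−x)^l y^k(1−y)^s z^j(1−z)^q/(1−(1−xy)z)^{q+h−r} · dx dy dz/(1−(1−xy)z)`,
where `C = {|x| = ρ₁}`, `C_x = {|y − 1/x| = ρ₂}`, `C_{x,y} = {|z − (1−xy)^{−1}| = ρ₃}`" (Theorem 3.1), the contour
integral being `Θ = ⟨ϑ, σ⟩`-invariant (Lemma 3.1).

## This file: the closed form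

For NON-NEGATIVE parameters each of the three circles of (3.1) encloses exactly one singularity of the successive
integrands (`z = (1−xy)^{−1}`, then `y = 1/x`, then `x = 0`), so `Ĩ` is an ITERATED RESIDUE — this is how the source
evaluates `Ĩ^{(t)} = 1` in (3.9)–(3.10) ("`= −(2πi)^{−2}∫∫ x^{h_t−1}y^{h_t}/(1−xy) … = (2πi)^{−1}∫ dx/x = 1`"). We carry
that computation out for ALL non-negative parameters: Taylor-expanding the polynomial numerator about the centre of
each circle (`Polynomial.taylor` / `Polynomial.hasseDeriv`) and using `∮_{|ζ−c|=R}(ζ−c)^m dζ = 2πi·[m = −1]`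
(Mathlib's `circleIntegral.integral_sub_zpow_of_ne`, `circleIntegral.integral_sub_center_inv`) gives
(`contourI_ofNat`, `contourI_eq_Acoef`)

  `Ĩ(h,j,k,l,m,q,r,s) = A := Σ_{a,b} (−1)^a C(a+n,n)·[u^{a+n}](u^j(1−u)^q) · C(a+b+n,a+n)·[u^{a+b+n}](u^k(1−u)^s)
                               · [u^{a+b+n−h}]((1−u)^l)`,   `n = q+h−r ≥ 0`

(and `Ĩ = 0` when `q+h−r < 0`, the integrand being a polynomial in `z`), an INTEGER independent of the radii
(`Theorem31.Acoef`, over `ℤ`). The companion file `Theorem31Proofs.lean` runs the descent of Theorem 2.1 on this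
closed form and proves `theorem31_holds` (and Lemma 3.1 as a corollary).

DEVIATION from the printed road (recorded, not hidden): the source proves Lemma 3.1 FIRST, by deforming the three
cycles and applying the birational change of variables (2.6) to the 3-cycle (3.5) ("`V` (with a suitable orientation) …
can be taken to be `|X| = ρ'₁, |Y| = ρ'₂, |Z| = ρ'₃`"); Mathlib has no multivariable contour-deformation tool, so we
evaluate `Ĩ` in closed form instead and obtain Lemma 3.1 AFTER Theorem 3.1. Everything here is PROVED; no definition
of the source is changed (`contourI`, `contourIntegrand` are those of `GroupStructure.lean`); no named fact.

HONEST FRAMING (cells pub-zeta5 / zeta5-irr): Rhin–Viola's `ζ(3)` bookkeeping AS PRINTED in 2001; nothing here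
concerns `ζ(5)`; no record is moved.
-/

noncomputable section

open MeasureTheory Set Metric Polynomial Finset

namespace Literature.NumberTheory.Irrationality.RhinViola2001

namespace Theorem31

/-! ### One circle: `∮ p(ζ)(ζ−c)^m dζ` for a polynomial `p` -/

/-- The Taylor coefficient `[u^m] p(c+u)` with an integer index (`0` for `m < 0`) — the residue bookkeeping of
(3.9)–(3.10). [cite: RhinViola2001, §3 (3.9)–(3.10)] -/
def tcoeff (p : ℂ[X]) (c : ℂ) (m : ℤ) : ℂ := if 0 ≤ m then (taylor c p).coeff m.toNat else 0

/-- `tcoeff` vanishes at negative indices. [cite: RhinViola2001, §3 (3.9)–(3.10)] -/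
theorem tcoeff_of_neg (p : ℂ[X]) (c : ℂ) {m : ℤ} (hm : m < 0) : tcoeff p c m = 0 := if_neg (not_le.mpr hm)

/-- At a natural index, `tcoeff p c n = (hasseDeriv n p)(c)`. [cite: RhinViola2001, §3 (3.9)–(3.10)] -/
theorem tcoeff_natCast (p : ℂ[X]) (c : ℂ) (n : ℕ) : tcoeff p c n = (hasseDeriv n p).eval c := by
  simp [tcoeff, taylor_coeff]

/-- `(hasseDeriv n p)(c) = Σ_{i<N} C(i+n,n) p_{i+n} c^i` for any `N > deg p`. [cite: RhinViola2001, §3 (3.9)–(3.10)] -/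
theorem hasseDeriv_eval_eq_sum (p : ℂ[X]) (n : ℕ) (c : ℂ) {N : ℕ} (hN : p.natDegree < N) :
    (hasseDeriv n p).eval c = ∑ i ∈ range N, ((i + n).choose n : ℂ) * p.coeff (i + n) * c ^ i := by
  rw [eval_eq_sum_range' (n := N) (lt_of_le_of_lt (natDegree_hasseDeriv_le p n) (by omega))]
  simp [hasseDeriv_coeff, mul_assoc]

/-- On a circle of positive radius the variable never meets the centre. [folklore] -/
private theorem sub_ne_zero_of_mem_sphere {c ζ : ℂ} {R : ℝ} (hR : 0 < R) (hζ : ζ ∈ sphere c R) : ζ - c ≠ 0 := by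
  rw [sub_ne_zero]
  rintro rfl
  rw [mem_sphere, dist_self] at hζ
  exact hR.ne' hζ.symm

/-- **One residue.** For a polynomial `p`, a centre `c`, a radius `R > 0` and an integer `m`:
`∮_{|ζ−c|=R} p(ζ)(ζ−c)^m dζ = 2πi·[u^{−m−1}] p(c+u)` — the termwise evaluation used three times in (3.9)–(3.10).
[cite: RhinViola2001, §3, proof of Theorem 3.1 ((3.9)–(3.10))] -/
theorem circleIntegral_eval_mul_zpow (p : ℂ[X]) (c : ℂ) {R : ℝ} (hR : 0 < R) (m : ℤ) :
    (∮ ζ in C(c, R), p.eval ζ * (ζ - c) ^ m) = 2 * Real.pi * Complex.I * tcoeff p c (-m - 1) := by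
  set N : ℕ := p.natDegree + (-m - 1).toNat + 1 with hN
  have hdeg : (taylor c p).natDegree < N := by rw [natDegree_taylor]; omega
  have hexp : ∀ ζ : ℂ, p.eval ζ = ∑ i ∈ range N, (taylor c p).coeff i * (ζ - c) ^ i := by
    intro ζ
    rw [← taylor_eval_sub c p ζ]
    exact eval_eq_sum_range' hdeg (ζ - c)
  have hcongr : EqOn (fun ζ => p.eval ζ * (ζ - c) ^ m)
      (fun ζ => ∑ i ∈ range N, (taylor c p).coeff i * (ζ - c) ^ ((i : ℤ) + m)) (sphere c R) := by
    intro ζ hζ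
    simp only [hexp ζ, Finset.sum_mul]
    refine Finset.sum_congr rfl fun i _ => ?_
    rw [mul_assoc, zpow_add₀ (sub_ne_zero_of_mem_sphere hR hζ), zpow_natCast]
  have hint : ∀ i ∈ range N,
      CircleIntegrable (fun ζ => (taylor c p).coeff i * (ζ - c) ^ ((i : ℤ) + m)) c R := by
    intro i _
    refine ContinuousOn.circleIntegrable hR.le (continuousOn_const.mul ?_)
    exact (continuousOn_id.sub continuousOn_const).zpow₀ _
      fun ζ hζ => Or.inl (sub_ne_zero_of_mem_sphere hR hζ)
  rw [circleIntegral.integral_congr hR.le hcongr, circleIntegral.integral_fun_sum hint]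
  have hterm : ∀ i ∈ range N,
      (∮ ζ in C(c, R), (taylor c p).coeff i * (ζ - c) ^ ((i : ℤ) + m))
        = if i = (-m - 1).toNat ∧ 0 ≤ -m - 1 then (taylor c p).coeff i * (2 * Real.pi * Complex.I) else 0 := by
    intro i _
    rw [circleIntegral.integral_const_mul]
    split_ifs with hi
    · rw [show (i : ℤ) + m = -1 by omega]
      simp_rw [zpow_neg_one]
      rw [circleIntegral.integral_sub_center_inv c hR.ne']
    · rw [circleIntegral.integral_sub_zpow_of_ne (by omega), mul_zero]
  rw [Finset.sum_congr rfl hterm]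
  unfold tcoeff
  by_cases hm : 0 ≤ -m - 1
  · simp only [hm, and_true, if_true]
    rw [Finset.sum_ite_eq' (range N) ((-m - 1).toNat)
      (fun i => (taylor c p).coeff i * (2 * Real.pi * Complex.I)),
      if_pos (by simp only [Finset.mem_range]; omega)]
    ring
  · simp only [hm, and_false, if_false, Finset.sum_const_zero, mul_zero]


/-! ### The three polynomial numerators `u^a(1−u)^b` and their coefficients -/

/-- `[u^c](u^a(1−u)^b)` over `ℤ` — the integer data of the closed form. [cite: RhinViola2001, §3 (3.9)–(3.10)] -/
def bc (a b c : ℕ) : ℤ := ((X : ℤ[X]) ^ a * (1 - X) ^ b).coeff c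

/-- `u^a(1−u)^b` as a complex polynomial. [cite: RhinViola2001, §3 (3.1)] -/
def pC (a b : ℕ) : ℂ[X] := Polynomial.map (Int.castRingHom ℂ) ((X : ℤ[X]) ^ a * (1 - X) ^ b)

/-- `pC a b = X^a (1−X)^b`. [cite: RhinViola2001, §3 (3.1)] -/
theorem pC_eq (a b : ℕ) : pC a b = (X : ℂ[X]) ^ a * (1 - X) ^ b := by
  simp [pC, Polynomial.map_mul, Polynomial.map_pow, Polynomial.map_sub]

/-- Evaluation: `(pC a b)(ζ) = ζ^a(1−ζ)^b`. [cite: RhinViola2001, §3 (3.1)] -/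
theorem eval_pC (a b : ℕ) (ζ : ℂ) : (pC a b).eval ζ = ζ ^ a * (1 - ζ) ^ b := by
  simp [pC_eq]

/-- Coefficients: `[u^c] pC a b = bc a b c`. [cite: RhinViola2001, §3 (3.9)–(3.10)] -/
theorem coeff_pC (a b c : ℕ) : (pC a b).coeff c = (bc a b c : ℂ) := by
  simp only [pC, bc, Polynomial.coeff_map, eq_intCast]

/-- Degree bound `deg(u^a(1−u)^b) < a + b + 1`. [cite: RhinViola2001, §3 (3.1)] -/
theorem natDegree_pC_lt (a b : ℕ) : (pC a b).natDegree < a + b + 1 := by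
  rw [pC_eq]
  have h1 : ((X : ℂ[X]) ^ a).natDegree ≤ a := (natDegree_X_pow (R := ℂ) a).le
  have h0 : (1 - X : ℂ[X]).natDegree ≤ 1 := (natDegree_sub_le _ _).trans (by simp)
  have h2 : ((1 - X : ℂ[X]) ^ b).natDegree ≤ b :=
    calc ((1 - X : ℂ[X]) ^ b).natDegree ≤ b * (1 - X : ℂ[X]).natDegree := natDegree_pow_le
      _ ≤ b * 1 := Nat.mul_le_mul_left _ h0
      _ = b := mul_one b
  exact Nat.lt_succ_of_le ((natDegree_mul_le).trans (add_le_add h1 h2))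

/-! ### Level `z`: the circle `C_{x,y} = {|z − (1−xy)^{−1}| = ρ₃}` -/

/-- **Level `z`.** For `w ≠ 0` (here `w = 1 − xy`), any `ρ > 0` and any integer exponent `e`:
`∮_{|z−w^{−1}|=ρ} z^j(1−z)^q/(1−wz)^e dz = 2πi·(−w)^{−e}·[u^{e−1}]((w^{−1}+u)^j(1−w^{−1}−u)^q)` — the only
singularity inside (indeed anywhere) is the centre `z = w^{−1}`. [cite: RhinViola2001, §3 (3.1), (3.9)] -/
theorem level_z (j q : ℕ) (e : ℤ) {w : ℂ} (hw : w ≠ 0) {ρ : ℝ} (hρ : 0 < ρ) :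
    (∮ z in C(w⁻¹, ρ), z ^ j * (1 - z) ^ q / (1 - w * z) ^ e)
      = 2 * Real.pi * Complex.I * ((-w) ^ (-e) * tcoeff (pC j q) w⁻¹ (e - 1)) := by
  have key : ∀ z : ℂ, z ^ j * (1 - z) ^ q / (1 - w * z) ^ e
      = (-w) ^ (-e) * ((pC j q).eval z * (z - w⁻¹) ^ (-e)) := by
    intro z
    have h1 : 1 - w * z = -w * (z - w⁻¹) := by field_simp; ring
    rw [h1, mul_zpow, eval_pC, div_eq_mul_inv, mul_inv, ← zpow_neg, ← zpow_neg]
    ring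
  simp_rw [key]
  rw [circleIntegral.integral_const_mul, circleIntegral_eval_mul_zpow _ _ hρ, neg_neg]
  ring

/-! ### Level `y`: the circle `C_x = {|y − 1/x| = ρ₂}` -/

/-- The change of centre at level `y`: `1 − xy = −x(y − 1/x)` (`x ≠ 0`). [cite: RhinViola2001, §3 (3.1)] -/
theorem one_sub_mul_eq {x : ℂ} (hx : x ≠ 0) (y : ℂ) : 1 - x * y = -x * (y - 1 / x) := by
  field_simp; ring

/-- **Level `y`.** For `x ≠ 0`, `ρ > 0`, `n ∈ ℕ` and a polynomial `p` of degree `< N`: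
`∮_{|y−1/x|=ρ} y^k(1−y)^s (−(1−xy))^{−(n+1)} (hasseDeriv n p)((1−xy)^{−1}) dy
 = 2πi Σ_{a<N} C(a+n,n) p_{a+n} x^{−(n+1)} (−x)^{−a} (hasseDeriv (n+a) (u^k(1−u)^s))(1/x)` — the only singularity
inside is the centre `y = 1/x`. [cite: RhinViola2001, §3 (3.1), (3.9)] -/
theorem level_y (k s n : ℕ) (p : ℂ[X]) {N : ℕ} (hN : p.natDegree < N) {x : ℂ} (hx : x ≠ 0) {ρ : ℝ}
    (hρ : 0 < ρ) :
    (∮ y in C(1 / x, ρ), y ^ k * (1 - y) ^ s *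
        (((-(1 - x * y)) ^ (n + 1))⁻¹ * (hasseDeriv n p).eval (1 - x * y)⁻¹))
      = 2 * Real.pi * Complex.I * ∑ a ∈ range N, ((a + n).choose n : ℂ) * p.coeff (a + n) *
          ((-1) ^ a * (x ^ (n + 1 + a))⁻¹ * (hasseDeriv (n + a) (pC k s)).eval (1 / x)) := by
  -- pointwise on the circle: a finite sum of `const · p_y(y) · (y − 1/x)^{−(n+1+a)}`
  have hcongr : EqOn
      (fun y : ℂ => y ^ k * (1 - y) ^ s * (((-(1 - x * y)) ^ (n + 1))⁻¹ * (hasseDeriv n p).eval (1 - x * y)⁻¹))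
      (fun y : ℂ => ∑ a ∈ range N, ((a + n).choose n : ℂ) * p.coeff (a + n) * ((-1) ^ a * (x ^ (n + 1 + a))⁻¹) *
        ((pC k s).eval y * (y - 1 / x) ^ (-(((n + 1 + a : ℕ)) : ℤ)))) (sphere (1 / x) ρ) := by
    intro y hy
    have hv : y - 1 / x ≠ 0 := sub_ne_zero_of_mem_sphere hρ hy
    have e1 : 1 - x * y = -(x * (y - 1 / x)) := by rw [one_sub_mul_eq hx y]; ring
    simp only
    rw [hasseDeriv_eval_eq_sum p n _ hN, Finset.mul_sum, Finset.mul_sum]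
    refine Finset.sum_congr rfl fun a _ => ?_
    rw [zpow_neg, zpow_natCast, eval_pC, e1]
    generalize hv' : y - 1 / x = v
    rw [hv'] at hv
    simp only [neg_neg, inv_neg, neg_pow (x * v)⁻¹, inv_pow, mul_pow]
    generalize (-1 : ℂ) ^ a = σ
    field_simp
    ring
  have hint : ∀ a ∈ range N, CircleIntegrable
      (fun y : ℂ => ((a + n).choose n : ℂ) * p.coeff (a + n) * ((-1) ^ a * (x ^ (n + 1 + a))⁻¹) *
        ((pC k s).eval y * (y - 1 / x) ^ (-(((n + 1 + a : ℕ)) : ℤ)))) (1 / x) ρ := by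
    intro a _
    refine ContinuousOn.circleIntegrable hρ.le (continuousOn_const.mul ?_)
    refine (Polynomial.continuous _).continuousOn.mul ?_
    exact (continuousOn_id.sub continuousOn_const).zpow₀ _
      fun y hy => Or.inl (sub_ne_zero_of_mem_sphere hρ hy)
  rw [circleIntegral.integral_congr hρ.le hcongr, circleIntegral.integral_fun_sum hint, Finset.mul_sum]
  refine Finset.sum_congr rfl fun a _ => ?_
  rw [circleIntegral.integral_const_mul, circleIntegral_eval_mul_zpow _ _ hρ,
    show -(-(((n + 1 + a : ℕ)) : ℤ)) - 1 = ((n + a : ℕ) : ℤ) by push_cast; ring, tcoeff_natCast]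
  ring

/-! ### Level `x`: the circle `C = {|x| = ρ₁}` -/

/-- **Level `x`.** For `ρ > 0` and naturals `h, l, t`:
`∮_{|x|=ρ} x^h(1−x)^l x^{−t} dx = 2πi·[u^{t−h−1}]((1−u)^l)` (zero if `t ≤ h`) — the only singularity inside is
`x = 0`. [cite: RhinViola2001, §3 (3.1), (3.9)] -/
theorem level_x (h l t : ℕ) {ρ : ℝ} (hρ : 0 < ρ) :
    (∮ x in C(0, ρ), x ^ h * (1 - x) ^ l * (x ^ t)⁻¹)
      = 2 * Real.pi * Complex.I * (if h + 1 ≤ t then ((bc 0 l (t - (h + 1)) : ℤ) : ℂ) else 0) := by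
  have hcongr : EqOn (fun x : ℂ => x ^ h * (1 - x) ^ l * (x ^ t)⁻¹)
      (fun x : ℂ => (pC 0 l).eval x * (x - 0) ^ ((h : ℤ) - t)) (sphere (0 : ℂ) ρ) := by
    intro x hx
    have hx0 : x ≠ 0 := by simpa using sub_ne_zero_of_mem_sphere hρ hx
    simp only
    rw [eval_pC, sub_zero, zpow_sub₀ hx0, zpow_natCast, zpow_natCast, pow_zero, one_mul, div_eq_mul_inv]
    ring
  rw [circleIntegral.integral_congr hρ.le hcongr, circleIntegral_eval_mul_zpow _ _ hρ]
  congr 1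
  by_cases ht : h + 1 ≤ t
  · rw [if_pos ht, show -((h : ℤ) - t) - 1 = ((t - (h + 1) : ℕ) : ℤ) by push_cast [ht]; omega, tcoeff_natCast,
      ← taylor_coeff, taylor_zero, coeff_pC]
  · rw [if_neg ht, tcoeff_of_neg _ _ (by omega)]


/-! ### The closed form -/

/-- Parameters given by eight naturals (every non-negative `Params` is of this form, `exists_eq_ofNat`).
[cite: RhinViola2001, Theorem 2.1 ("non-negative integers `h, j, k, l, m, q, r, s`")] -/
def ofNat (h j k l m q r s : ℕ) : Params := ⟨h, j, k, l, m, q, r, s⟩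

/-- A non-negative parameter set is an `ofNat`. [cite: RhinViola2001, Theorem 2.1] -/
theorem exists_eq_ofNat {P : Params} (hP : P.Nonneg) :
    ∃ h j k l m q r s : ℕ, P = ofNat h j k l m q r s := by
  obtain ⟨h0, h1, h2, h3, h4, h5, h6, h7⟩ := hP
  refine ⟨P.h.toNat, P.j.toNat, P.k.toNat, P.l.toNat, P.m.toNat, P.q.toNat, P.r.toNat, P.s.toNat, ?_⟩
  ext <;> simp only [ofNat] <;> omega

/-- The integrand of (3.1) at natural parameters, with the `z`-part separated.
[cite: RhinViola2001, §3 (3.1)] -/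
theorem contourIntegrand_ofNat (h j k l m q r s : ℕ) (x y z : ℂ) :
    contourIntegrand (ofNat h j k l m q r s) x y z
      = x ^ h * (1 - x) ^ l * y ^ k * (1 - y) ^ s *
          (z ^ j * (1 - z) ^ q / (1 - (1 - x * y) * z) ^ ((q : ℤ) + h - r + 1)) := by
  simp only [contourIntegrand, ofNat, zpow_natCast]
  ring

/-- **The closed form `A`** of the triple contour integral (3.1) at non-negative parameters with
`n = q + h − r ≥ 0` (an integer; the three factors are the three residues of (3.9)–(3.10) in general position):
`A = Σ_{a ≤ j+q} Σ_{b ≤ k+s} (−1)^a C(a+n,n)[u^{a+n}](u^j(1−u)^q) · C(a+b+n,a+n)[u^{a+b+n}](u^k(1−u)^s)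
       · [u^{a+b+n−h}]((1−u)^l)`. [cite: RhinViola2001, §3 Theorem 3.1 with (3.9)–(3.10)] -/
def Acoef (h j k l q s n : ℕ) : ℤ :=
  ∑ a ∈ range (j + q + 1), ∑ b ∈ range (k + s + 1),
    (-1) ^ a * ((a + n).choose n : ℤ) * bc j q (a + n) * ((b + (n + a)).choose (n + a) : ℤ) *
      bc k s (b + (n + a)) * (if h ≤ n + a + b then bc 0 l (n + a + b - h) else 0)

/-- On `C_x`: `y ≠ 1/x`, i.e. `1 − xy ≠ 0` (`x ≠ 0`). [cite: RhinViola2001, §3 (3.1)] -/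
theorem one_sub_mul_ne_zero {x y : ℂ} (hx : x ≠ 0) {ρ : ℝ} (hρ : 0 < ρ) (hy : y ∈ sphere (1 / x) ρ) :
    1 - x * y ≠ 0 := by
  rw [one_sub_mul_eq hx y]
  exact mul_ne_zero (neg_ne_zero.mpr hx) (sub_ne_zero_of_mem_sphere hρ hy)

/-- On `C`: `x ≠ 0`. [cite: RhinViola2001, §3 (3.1)] -/
theorem ne_zero_of_mem_sphere_zero {x : ℂ} {ρ : ℝ} (hρ : 0 < ρ) (hx : x ∈ sphere (0 : ℂ) ρ) : x ≠ 0 := by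
  simpa using sub_ne_zero_of_mem_sphere hρ hx

/-- A circle integral of the zero function vanishes. [folklore] -/
private theorem circleIntegral_zero_fun (c : ℂ) (R : ℝ) : (∮ _z in C(c, R), (0 : ℂ)) = 0 := by
  simp [circleIntegral]

/-- **The triple contour integral in closed form.** For natural parameters and any radii `ρ₁, ρ₂, ρ₃ > 0`:
`Ĩ(h,j,k,l,m,q,r,s) = A` (`Theorem31.Acoef`, with `n = q+h−r`) if `q + h ≥ r`, and `Ĩ = 0` if `q + h − r < 0`
("`Ĩ` vanishes if `q + h − r < 0`", p. 278). In particular `Ĩ` is an integer independent of the radii.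
[cite: RhinViola2001, §3 Theorem 3.1, (3.9)–(3.10), and p. 278] -/
theorem contourI_ofNat (h j k l m q r s : ℕ) {ρ₁ ρ₂ ρ₃ : ℝ} (h₁ : 0 < ρ₁) (h₂ : 0 < ρ₂) (h₃ : 0 < ρ₃) :
    contourI (ofNat h j k l m q r s) ρ₁ ρ₂ ρ₃
      = if r ≤ q + h then ((Acoef h j k l q s (q + h - r) : ℤ) : ℂ) else 0 := by
  unfold contourI
  -- Level z, for `1 − xy ≠ 0`
  have hz : ∀ x y : ℂ, 1 - x * y ≠ 0 →
      (∮ z in C((1 - x * y)⁻¹, ρ₃), contourIntegrand (ofNat h j k l m q r s) x y z)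
        = x ^ h * (1 - x) ^ l * y ^ k * (1 - y) ^ s * (2 * Real.pi * Complex.I *
            ((-(1 - x * y)) ^ (-((q : ℤ) + h - r + 1)) *
              tcoeff (pC j q) (1 - x * y)⁻¹ ((q : ℤ) + h - r + 1 - 1))) := by
    intro x y hw
    simp_rw [contourIntegrand_ofNat]
    rw [circleIntegral.integral_const_mul, level_z j q _ hw h₃]
  by_cases hr : r ≤ q + h
  · -- `n = q + h − r ≥ 0`
    rw [if_pos hr]
    obtain ⟨n, hn⟩ : ∃ n : ℕ, n = q + h - r := ⟨_, rfl⟩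
    rw [← hn]
    have he : (q : ℤ) + h - r + 1 = ((n + 1 : ℕ) : ℤ) := by push_cast; omega
    have he' : (q : ℤ) + h - r + 1 - 1 = (n : ℤ) := by omega
    -- Level z in the form fed to level y
    have hz' : ∀ x y : ℂ, 1 - x * y ≠ 0 →
        (∮ z in C((1 - x * y)⁻¹, ρ₃), contourIntegrand (ofNat h j k l m q r s) x y z)
          = (2 * Real.pi * Complex.I * (x ^ h * (1 - x) ^ l)) * (y ^ k * (1 - y) ^ s *
              (((-(1 - x * y)) ^ (n + 1))⁻¹ * (hasseDeriv n (pC j q)).eval (1 - x * y)⁻¹)) := by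
      intro x y hw
      rw [hz x y hw, he', tcoeff_natCast, he, zpow_neg, zpow_natCast]
      ring
    -- Level y, for `x ≠ 0`
    have hy : ∀ x : ℂ, x ≠ 0 →
        (∮ y in C(1 / x, ρ₂), ∮ z in C((1 - x * y)⁻¹, ρ₃), contourIntegrand (ofNat h j k l m q r s) x y z)
          = (2 * Real.pi * Complex.I) ^ 2 * ∑ a ∈ range (j + q + 1), ∑ b ∈ range (k + s + 1),
              ((a + n).choose n : ℂ) * (pC j q).coeff (a + n) *
                (((b + (n + a)).choose (n + a) : ℂ) * (pC k s).coeff (b + (n + a))) *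
                  ((-1) ^ a * (x ^ h * (1 - x) ^ l * (x ^ (n + 1 + a + b))⁻¹)) := by
      intro x hx
      rw [circleIntegral.integral_congr h₂.le (fun y hy => hz' x y (one_sub_mul_ne_zero hx h₂ hy)),
        circleIntegral.integral_const_mul, level_y k s n (pC j q) (natDegree_pC_lt j q) hx h₂]
      rw [Finset.mul_sum, Finset.mul_sum, Finset.mul_sum]
      refine Finset.sum_congr rfl fun a _ => ?_
      rw [hasseDeriv_eval_eq_sum (pC k s) (n + a) _ (natDegree_pC_lt k s), Finset.mul_sum, Finset.mul_sum,
        Finset.mul_sum, Finset.mul_sum, Finset.mul_sum]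
      refine Finset.sum_congr rfl fun b _ => ?_
      rw [one_div, inv_pow, pow_add x (n + 1 + a) b, mul_inv]
      ring
    -- Level x
    have hint : ∀ a ∈ range (j + q + 1), ∀ b ∈ range (k + s + 1), CircleIntegrable
        (fun x : ℂ => ((a + n).choose n : ℂ) * (pC j q).coeff (a + n) *
          (((b + (n + a)).choose (n + a) : ℂ) * (pC k s).coeff (b + (n + a))) *
            ((-1) ^ a * (x ^ h * (1 - x) ^ l * (x ^ (n + 1 + a + b))⁻¹))) 0 ρ₁ := by
      intro a _ b _
      refine ContinuousOn.circleIntegrable h₁.le (continuousOn_const.mul (continuousOn_const.mul ?_))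
      refine ((continuousOn_id.pow _).mul ((continuousOn_const.sub continuousOn_id).pow _)).mul ?_
      exact (continuousOn_id.pow _).inv₀ fun x hx => pow_ne_zero _ (ne_zero_of_mem_sphere_zero h₁ hx)
    rw [circleIntegral.integral_congr h₁.le (fun x hx => hy x (ne_zero_of_mem_sphere_zero h₁ hx)),
      circleIntegral.integral_const_mul,
      circleIntegral.integral_fun_sum (fun a ha => CircleIntegrable.fun_sum _ (hint a ha))]
    rw [Finset.mul_sum, Finset.mul_sum, Acoef, Int.cast_sum]
    refine Finset.sum_congr rfl fun a ha => ?_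
    rw [circleIntegral.integral_fun_sum (hint a ha), Finset.mul_sum, Finset.mul_sum, Int.cast_sum]
    refine Finset.sum_congr rfl fun b _ => ?_
    rw [circleIntegral.integral_const_mul, circleIntegral.integral_const_mul, level_x h l _ h₁]
    have hI : (2 * Real.pi * Complex.I : ℂ) ≠ 0 := by
      simp [Real.pi_ne_zero, Complex.I_ne_zero]
    have hite : (if h + 1 ≤ n + 1 + a + b then ((bc 0 l (n + 1 + a + b - (h + 1)) : ℤ) : ℂ) else 0)
        = (((if h ≤ n + a + b then bc 0 l (n + a + b - h) else 0 : ℤ)) : ℂ) := by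
      by_cases hh : h ≤ n + a + b
      · rw [if_pos (by omega), if_pos hh, show n + 1 + a + b - (h + 1) = n + a + b - h by omega]
      · rw [if_neg (by omega), if_neg hh, Int.cast_zero]
    rw [hite, coeff_pC, coeff_pC]
    field_simp
    push_cast
    ring
  · -- `q + h − r < 0`: the `z`-integrand is a polynomial
    rw [if_neg hr]
    have hz0 : ∀ x y : ℂ, 1 - x * y ≠ 0 →
        (∮ z in C((1 - x * y)⁻¹, ρ₃), contourIntegrand (ofNat h j k l m q r s) x y z) = 0 := by
      intro x y hw
      rw [hz x y hw, tcoeff_of_neg _ _ (by omega)]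
      simp
    have hy0 : ∀ x : ℂ, x ≠ 0 →
        (∮ y in C(1 / x, ρ₂), ∮ z in C((1 - x * y)⁻¹, ρ₃), contourIntegrand (ofNat h j k l m q r s) x y z)
          = 0 := by
      intro x hx
      rw [circleIntegral.integral_congr h₂.le (fun y hy => hz0 x y (one_sub_mul_ne_zero hx h₂ hy))]
      exact circleIntegral_zero_fun _ _
    rw [circleIntegral.integral_congr h₁.le (fun x hx => hy0 x (ne_zero_of_mem_sphere_zero h₁ hx)),
      circleIntegral_zero_fun, mul_zero]

/-- **Theorem 3.1, closed form, for every non-negative parameter set.** With `n = q + h − r`: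
`Ĩ(P) = A(P)` if `n ≥ 0` and `Ĩ(P) = 0` if `n < 0`, for all radii `ρ₁, ρ₂, ρ₃ > 0`.
[cite: RhinViola2001, §3 Theorem 3.1, (3.9)–(3.10), p. 278] -/
theorem contourI_eq_Acoef {P : Params} (hP : P.Nonneg) {ρ₁ ρ₂ ρ₃ : ℝ} (h₁ : 0 < ρ₁) (h₂ : 0 < ρ₂)
    (h₃ : 0 < ρ₃) :
    contourI P ρ₁ ρ₂ ρ₃ = if P.r ≤ P.q + P.h then
      ((Acoef P.h.toNat P.j.toNat P.k.toNat P.l.toNat P.q.toNat P.s.toNat (P.q + P.h - P.r).toNat : ℤ) : ℂ)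
      else 0 := by
  obtain ⟨h, j, k, l, m, q, r, s, rfl⟩ := exists_eq_ofNat hP
  rw [contourI_ofNat h j k l m q r s h₁ h₂ h₃]
  simp only [ofNat, Int.toNat_natCast]
  by_cases hr : r ≤ q + h
  · rw [if_pos hr, if_pos (by exact_mod_cast hr), show ((q : ℤ) + h - r).toNat = q + h - r by omega]
  · rw [if_neg hr, if_neg (by exact_mod_cast hr)]

/-- **`Ĩ` does not depend on the radii** (the content of the remark "for any `ρ₁, ρ₂, ρ₃ > 0`" in Lemma 3.1).
[cite: RhinViola2001, §3 Lemma 3.1] -/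
theorem contourI_radii {P : Params} (hP : P.Nonneg) {ρ₁ ρ₂ ρ₃ ρ₁' ρ₂' ρ₃' : ℝ} (h₁ : 0 < ρ₁) (h₂ : 0 < ρ₂)
    (h₃ : 0 < ρ₃) (h₁' : 0 < ρ₁') (h₂' : 0 < ρ₂') (h₃' : 0 < ρ₃') :
    contourI P ρ₁ ρ₂ ρ₃ = contourI P ρ₁' ρ₂' ρ₃' := by
  rw [contourI_eq_Acoef hP h₁ h₂ h₃, contourI_eq_Acoef hP h₁' h₂' h₃']

end Theorem31

end Literature.NumberTheory.Irrationality.RhinViola2001
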